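import Summits.BirchSwinnertonDyer.BirchSwinnertonDyer.Theorems.EisensteinPrimesAcTwistDeformationShapiro
import Summits.BirchSwinnertonDyer.BirchSwinnertonDyer.Theorems.EisensteinPrimesUnrSelmerImprimitiveFiniteness
import Literature.NumberTheory.EllipticCurves.IwasawaDualFunctorialityProofs
import HarnessLib

/-!
# Route `EisensteinPrimes` (rung K5), crux 2 `GoodLatticeBDPValue`, line `halves` v16, stub
# `stub_imprimCorank`, road (A): the [RH]-TRANSPORT — `corank_Λ S_{𝓛_v}(K, 𝐃₁) = 0` from the
# Rubin–Hida cotorsion of `H¹_{𝓕_nr}(K_∞, M)` along the Shapiro descent (helper for stmt-BirchSwinnertonDyer-19032)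

Cell `bsd-eis`, seat `bsd-line-x1-p1` LEAD g2 (D-0154 row 4); fifth file of road (A). The ONE input of
`…AcTwistDeformationSUR.bigRep_fullAt_SUR` beyond the published facts is `HasCorank Λ S_{𝓛_v}(K, 𝐃₁) 0`
with `S_{𝓛_v}` cofinitely generated. THIS FILE derives it from the hypothesis [RH] of
`KellerYin2024.prop125_residualPair_unrSelmer_corank_ge` — "every `Λ`-dual datum `D` of
`H¹_{𝓕_nr}(K_∞, M) = unrSelmer κ M v̄ ∅` is finitely generated and torsion" (Keller–Yin Thm. 1.2.2 =
Rubin 1991 + Hida 2010, consumed BY NAME by the crux):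

* §1 `shapiroDescent_mem_unrSelmer_of_mem_fullAtSelmer` — the Shapiro descent LANDS in
  `H¹_{𝓕_nr}(K_∞, M)`: a class of `S_{𝓛_v}(K, 𝐃₁)` (no condition at `v`, locally trivial at every other
  place of `Σ`) descends to a class unramified at every finite place `≠ v` (`…Shapiro`: `loc_w = 0` ⇒
  `awayKer` ⇒ `unramifiedKer`; `w ∉ S` ⇒ unramified) — at `v̄` the strict datum `M⁺ = 0` of
  `bdpData M p v̄` makes Greenberg's inertia condition the unramified one, at `v` the relaxed datum
  `M⁺ = M` imposes nothing;
* §2 `isDualPair_characterModule_selmer` — `Hom(S_𝓛(K, 𝐃₁), ℚ/ℤ)` with its coefficient `Λ`-structure is an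
  axiomatic dual pair for `ψ' = (T • ·)` (classes are `p`-primary and `T`-locally-nilpotent: a continuous
  cocycle on the compact `G_{K,S}` has finitely many values in the discrete `𝐃₁`);
* §3 `hasCorank_fullAtSelmer_zero_of_datumDualData` — by the tree's functoriality of dual pairs
  (`IwasawaDual.IsDualPair.exists_linearMap_comp_surjective`, along the INJECTIVE, `T ↔ conj_γ − 1`
  intertwining descent) the dual `D.X` of `H¹_{𝓕_nr}(K_∞, M)` SURJECTS `Λ`-linearly onto
  `Hom(S_{𝓛_v}(K, 𝐃₁), ℚ/ℤ)`; hence the latter is finitely generated torsion: `HasCorank … 0` and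
  `IsCofinitelyGenerated`.

Theorems only; no named fact, no `sorry`. HONEST FRAMING: conditional on the [RH] hypothesis it consumes
(a PUBLISHED fact by name in the crux); closes nothing by itself (`--supports`). References:
[KellerYin2024] Thm. 1.2.2, Rem. 1.2.3 (ii) (arXiv:2402.12781v2 TeX L676–712); [Greenberg2006] Thm. 3
p. 342 ("as `Λ`-modules"); [GreenbergLNM1716] §1 p. 60; [Lang1990] Ch. 5 §1.
-/

set_option autoImplicit false
set_option linter.dupNamespace false

noncomputable section

open scoped Classical
open NumberField IsDedekindDomain Field Multiplicative PowerSeries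
open Literature.NumberTheory.EllipticCurves Literature.NumberTheory.EllipticCurves.GreenbergSelmer
  Literature.NumberTheory.EllipticCurves.GreenbergVatsal2000 Literature.NumberTheory.GaloisRepresentations
  Literature.NumberTheory.EllipticCurves.KellerYin2024 Literature.NumberTheory.EllipticCurves.IwasawaDual
  Literature.NumberTheory.IwasawaTheory Literature.NumberTheory.IwasawaTheory.Greenberg2016
  Literature.NumberTheory.IwasawaTheory.Greenberg2006
  Summit.BirchSwinnertonDyer.BirchSwinnertonDyer.Theorems.GreenbergFullAtSelmer
  Summit.BirchSwinnertonDyer.BirchSwinnertonDyer.Theorems.UnrSelmerImprimitiveFiniteness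
  Summit.BirchSwinnertonDyer.BirchSwinnertonDyer.Theorems.TwistDeformationCofree

namespace Summit.BirchSwinnertonDyer.BirchSwinnertonDyer.Theorems.AcTwistDeformation

section Landing

variable {K : Type} [Field K] [NumberField K] (S : Set (HeightOneSpectrum (𝓞 K))) {p : ℕ} [Fact p.Prime]
  {A : Type} [AddCommGroup A] [Module ℤ_[p] A] [TopologicalSpace A] [DiscreteTopology A]
  [TopologicalSpace (PowerSeries ℤ_[p])] [IsTopologicalRing (PowerSeries ℤ_[p])]
  [IsTopologicalAddGroup (BigRepModule ℤ_[p] p A)] [ContinuousSMul (PowerSeries ℤ_[p]) (BigRepModule ℤ_[p] p A)]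
  (hS : ∀ v : HeightOneSpectrum (𝓞 K), ((p : ℕ) : 𝓞 K) ∈ v.asIdeal → v ∈ S)
  (κ : ZpExtension K p) (ρ₀ : ContinuousRep (GaloisGroupUnramifiedOutside K S) ℤ_[p] A)
  {M : Type} [AddCommGroup M] [DistribMulAction (absoluteGaloisGroup K) M] [TopologicalSpace M]
  [DiscreteTopology M]
  (ψ : A ≃+ M) (hψ : ∀ (σ : absoluteGaloisGroup K) (a : A), ψ (ρ₀ (toUnramifiedQuot K S σ) a) = σ • ψ a)

/-! ## §1 The descent lands in `H¹_{𝓕_nr}(K_∞, M)` -/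

/-- Locally trivial above `w` ⇒ unramified at `w`: `awayKer H M w ≤ unramifiedKer H M w` (restriction to
`H ⊓ I_w` factors through `H ⊓ D_w`). [cite: GreenbergVatsal2000, §2 p. 17] -/
theorem awayKer_le_unramifiedKer (H : Subgroup (absoluteGaloisGroup K)) [H.Normal]
    (w : HeightOneSpectrum (𝓞 K)) :
    awayKer H M w ≤ GreenbergVatsal2000.unramifiedKer H M w := by
  intro c hc
  obtain ⟨z, rfl⟩ := oneCocycleClass_surjective _ c
  rw [awayKer, AddMonoidHom.mem_ker, resOfLe, resH1Hom_oneCocycleClass_eq', oneCocycleClass_eq_zero_iff] at hc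
  obtain ⟨a, ha⟩ := hc
  rw [GreenbergVatsal2000.unramifiedKer, AddMonoidHom.mem_ker, resH1Hom_oneCocycleClass_eq',
    oneCocycleClass_eq_zero_iff]
  refine ⟨a, fun x ↦ ?_⟩
  have hx := (mem_inertiaIn_iff H w x).1 x.2
  have h := ha ⟨(x : decomp (K := K) w), Subgroup.mem_inf.2 ⟨hx.1, (x : decomp (K := K) w).2⟩⟩
  exact h

include hψ in
/-- **The Shapiro descent LANDS in `H¹_{𝓕_nr}(K_∞, M) = unrSelmer κ M v̄ ∅`.** For `p = v v̄` the only
places above `p` (`hSp`) and `ξ ∈ S_{𝓛_v}(K, 𝐃₁)` (`𝓛_v`: no condition at `v`, `0` at every other place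
of `Σ`), `F ξ` is unramified at every finite `w ∤ p` (at `w ∈ S`: `loc_w = 0` ⇒ locally trivial ⇒
unramified; at `w ∉ S`: inertia dies in `G_{K,S}`) and satisfies Greenberg's condition for Castella's
datum `bdpData M p v̄` (`M⁺_v̄ = 0`: strict = locally trivial, from `loc_v̄ = 0`; `M⁺_v = M`: no
condition) — all of it after every conjugation `conj_σ`, `σ ∈ Γ_K`.
[cite: KellerYin2024, §1.2 Def. (3) and Rem. 1.2.3 (i) (arXiv:2402.12781v2 TeX L641–690)]
[cite: GreenbergVatsal2000, §2 pp. 16–17, 20] -/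
theorem shapiroDescent_mem_unrSelmer_of_mem_fullAtSelmer (hA : ∀ a : A, ∃ k : ℕ, p ^ k • a = 0)
    {F : (bigRep (κ.liftUnramifiedOutside S hS) ρ₀).H 1 →+ subgroupH1 κ.kerSubgroup M}
    (hF : ∀ (c : contOneCocycles (bigRep (κ.liftUnramifiedOutside S hS) ρ₀).toTopRep)
      (z : contOneCocycles (discreteTopRep κ.kerSubgroup M)),
      (∀ h : κ.kerSubgroup, z.1 h = ψ ((c.1 (toUnramifiedQuot K S h) : BigRepModule ℤ_[p] p A) 0)) →
      F (oneCocycleClass _ c) = oneCocycleClass _ z)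
    {v vbar : HeightOneSpectrum (𝓞 K)} (hv : ((p : ℕ) : 𝓞 K) ∈ v.asIdeal) (hne : vbar ≠ v)
    (hSp : ∀ w : HeightOneSpectrum (𝓞 K), ((p : ℕ) : 𝓞 K) ∈ w.asIdeal → w = v ∨ w = vbar)
    (ξ : (bigRep (κ.liftUnramifiedOutside S hS) ρ₀).H 1)
    (hξ : ξ ∈ (fullAtSpecification S (bigRep (κ.liftUnramifiedOutside S hS) ρ₀) (Sum.inr v)).selmer) :
    F ξ ∈ unrSelmer κ M vbar (∅ : Set (HeightOneSpectrum (𝓞 K))) := by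
  obtain ⟨c, rfl⟩ := oneCocycleClass_surjective _ ξ
  rw [mem_selmer_fullAtSpecification_iff] at hξ
  -- `loc_w = 0` at every finite `w ∈ S`, `w ≠ v`
  have hloc : ∀ w : HeightOneSpectrum (𝓞 K), w ∈ S → w ≠ v →
      loc S (bigRep (κ.liftUnramifiedOutside S hS) ρ₀) (Sum.inr w) 1 (oneCocycleClass _ c) = 0 :=
    fun w hw hwv ↦ hξ ⟨Sum.inr w, (inSigma_inr_iff S w).mpr hw⟩ (fun h ↦ hwv (Sum.inr_injective h))
  rw [unrSelmer, datumSelmerInfty_eq, mem_datumSelmer_iff, mem_unramifiedOutside_iff]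
  refine ⟨fun w _ hpw σ ↦ ?_, fun w hpw σ ↦ ?_⟩
  · by_cases hwS : w ∈ S
    · have hwv : w ≠ v := fun h ↦ hpw (h ▸ hv)
      exact awayKer_le_unramifiedKer κ.kerSubgroup w
        (conjH1_shapiroDescent_mem_awayKer_of_loc_eq_zero S hS κ ρ₀ ψ hψ hA hF w c (hloc w hwS hwv) σ)
    · exact conjH1_shapiroDescent_mem_unramifiedKer_of_not_mem S hS κ ρ₀ ψ hψ hF hwS c σ
  · rcases hSp w hpw with rfl | rfl
    · -- at `v`: the relaxed datum imposes nothing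
      rw [Castella2018.AcSelmer.bdpData_of_ne (M := M) p vbar hpw hne.symm]
      refine (Castella2018.AcSelmer.relaxedDatum M w).strictKer_le_greenbergKer κ.kerSubgroup ?_
      rw [Castella2018.AcSelmer.strictKer_relaxedDatum_eq_top]
      trivial
    · -- at `v̄`: the strict datum `M⁺ = 0`, locally trivial by `loc_v̄ = 0`
      rw [Castella2018.AcSelmer.bdpData_self (M := M) p w hpw]
      refine (Castella2018.AcSelmer.strictDatum M w).strictKer_le_greenbergKer κ.kerSubgroup ?_
      rw [Literature.NumberTheory.EllipticCurves.BigGaloisRep.strictKer_strictDatum_eq_awayKer]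
      exact conjH1_shapiroDescent_mem_awayKer_of_loc_eq_zero S hS κ ρ₀ ψ hψ hA hF w c
        (hloc w (hS w hpw) hne) σ

/-! ## §2 `Hom(S_𝓛(K, 𝐃₁), ℚ/ℤ)` is a dual pair for `ψ' = (T • ·)` -/

omit [IsTopologicalRing (PowerSeries ℤ_[p])] in
/-- **Classes of `H¹(K_Σ/K, 𝐃₁)` are `p`-primary and `T`-locally nilpotent**: a continuous cocycle on the
COMPACT `G_{K,S}` takes finitely many values in the discrete `𝐃₁`, each killed by a power of `p` and of
`T = τ₁ − 1`. [cite: GreenbergLNM1716, §1 p. 60 (after Conj. 1.3)] [cite: SkinnerUrban2014, §3.1.1] -/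
theorem exists_pow_smul_eq_zero_and_X_pow_smul_eq_zero
    (ξ : (bigRep (κ.liftUnramifiedOutside S hS) ρ₀).H 1) :
    (∃ k : ℕ, p ^ k • ξ = 0) ∧ ∃ N : ℕ, (PowerSeries.X : PowerSeries ℤ_[p]) ^ N • ξ = 0 := by
  set X : TopRep (PowerSeries ℤ_[p]) (GaloisGroupUnramifiedOutside K S) :=
    (bigRep (κ.liftUnramifiedOutside S hS) ρ₀).toTopRep with hX
  obtain ⟨c, rfl⟩ := oneCocycleClass_surjective X ξ
  have hfin : (Set.range fun g : GaloisGroupUnramifiedOutside K S ↦ (c.1 g : BigRepModule ℤ_[p] p A)).Finite :=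
    (isCompact_range c.1.continuous).finite_of_discrete
  constructor
  · obtain ⟨k, hk⟩ := BigRepModule.exists_uniform_pow_smul_eq_zero hfin
      (fun g ↦ exists_pow_smul_eq_zero (c.1 g : BigRepModule ℤ_[p] p A))
    refine ⟨k, ?_⟩
    have hc0 : p ^ k • c = 0 := Subtype.ext (ContinuousMap.ext fun g ↦ by
      change p ^ k • (c.1 g : BigRepModule ℤ_[p] p A) = 0
      exact hk g)
    change p ^ k • oneCocycleClassₗ X c = 0
    rw [← map_nsmul, hc0, map_zero]
  · -- a uniform `T`-exponent over the finitely many values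
    have hval : ∀ Φ ∈ hfin.toFinset, ∃ N : ℕ,
        (BigRepModule.shiftSubOne ^ N : BigRepModule ℤ_[p] p A →ₗ[ℤ_[p]] BigRepModule ℤ_[p] p A) Φ = 0 :=
      fun Φ _ ↦ BigRepModule.shiftSubOne_locNil Φ
    choose! Nv hNv using hval
    refine ⟨hfin.toFinset.sup Nv, ?_⟩
    have hpt : ∀ g : GaloisGroupUnramifiedOutside K S,
        (PowerSeries.X : PowerSeries ℤ_[p]) ^ (hfin.toFinset.sup Nv) • (c.1 g : BigRepModule ℤ_[p] p A) = 0 := by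
      intro g
      have hg : (c.1 g : BigRepModule ℤ_[p] p A) ∈ hfin.toFinset := hfin.mem_toFinset.2 ⟨g, rfl⟩
      obtain ⟨m, hm⟩ := Nat.exists_eq_add_of_le (Finset.le_sup (f := Nv) hg)
      have hXpow : ∀ (n : ℕ) (Φ : BigRepModule ℤ_[p] p A), (PowerSeries.X : PowerSeries ℤ_[p]) ^ n • Φ =
          (BigRepModule.shiftSubOne ^ n : BigRepModule ℤ_[p] p A →ₗ[ℤ_[p]] BigRepModule ℤ_[p] p A) Φ := by
        intro n Φ
        induction n with
        | zero => rw [pow_zero, one_smul, pow_zero, Module.End.one_apply]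
        | succ n ih => rw [pow_succ', mul_smul, ih, BigRepModule.X_smul, pow_succ', Module.End.mul_apply]
      rw [hXpow, hm, add_comm, pow_add, Module.End.mul_apply, hNv _ hg, map_zero]
    have hc0 : (PowerSeries.X : PowerSeries ℤ_[p]) ^ (hfin.toFinset.sup Nv) • c = 0 :=
      Subtype.ext (ContinuousMap.ext fun g ↦ hpt g)
    have h0 : oneCocycleClass X ((PowerSeries.X : PowerSeries ℤ_[p]) ^ (hfin.toFinset.sup Nv) • c) = 0 := by
      rw [hc0, oneCocycleClass_zero]
    rw [oneCocycleClass_smul] at h0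
    exact h0

omit [NumberField K] [TopologicalSpace (PowerSeries ℤ_[p])] [IsTopologicalRing (PowerSeries ℤ_[p])]
  [IsTopologicalAddGroup (BigRepModule ℤ_[p] p A)] [ContinuousSMul (PowerSeries ℤ_[p]) (BigRepModule ℤ_[p] p A)] in
/-- `a ≡ (a mod p^k) (mod p^k)` in `ℤ_p`: `a = n + p^k b` with `n = (toZModPow k a).val`.
[cite: SerreLocalFields1979, II §5] -/
theorem padicInt_exists_eq_val_add_pow_mul (k : ℕ) (a : ℤ_[p]) :
    ∃ b : ℤ_[p], a = ((PadicInt.toZModPow k a).val : ℤ_[p]) + (p : ℤ_[p]) ^ k * b := by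
  have hmem : a - ((PadicInt.toZModPow k a).val : ℤ_[p]) ∈ Ideal.span {(p : ℤ_[p]) ^ k} := by
    rw [← PadicInt.ker_toZModPow, RingHom.mem_ker, map_sub, map_natCast, ZMod.natCast_zmod_val,
      sub_self]
  obtain ⟨b, hb⟩ := Ideal.mem_span_singleton'.mp hmem
  exact ⟨b, by rw [mul_comm] at hb; rw [hb]; abel⟩

omit [IsTopologicalRing (PowerSeries ℤ_[p])] [IsTopologicalAddGroup (BigRepModule ℤ_[p] p A)] in
/-- **`Hom(S_𝓛(K, 𝐃₁), ℚ/ℤ)`, with its coefficient `Λ`-structure, is an axiomatic dual pair** for the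
endomorphism `ψ' = (T • ·)` of `S_𝓛(K, 𝐃₁)` (`IwasawaDual.IsDualPair`): `toDual = id`, `T` acts as `ψ'`
tautologically, constants `c ∈ ℤ_p` act on `p^k`-torsion classes through `c mod p^k`
(`c = (c mod p^k) + p^k b`), and `(p, T)` is locally nilpotent (previous lemma).
[cite: GreenbergLNM1716, §1 p. 60] [cite: Greenberg2016Selmer, §1 p. 3 L15–21 (H¹(K_Σ/K, 𝐃) as a discrete R-module)] -/
theorem isDualPair_characterModule_selmer (L : Specification S (bigRep (κ.liftUnramifiedOutside S hS) ρ₀)) :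
    IsDualPair p (DistribSMul.toAddMonoidHom L.selmer (PowerSeries.X : PowerSeries ℤ_[p]) :
        AddMonoid.End L.selmer)
      (AddMonoidHom.id (CharacterModule L.selmer) :
        CharacterModule L.selmer →+ (L.selmer →+ AddCircle (1 : ℚ))) where
  bijective := Function.bijective_id
  T_smul x s := rfl
  C_smul c x s k hk := by
    obtain ⟨b, hb⟩ := padicInt_exists_eq_val_add_pow_mul (p := p) k c
    change x (PowerSeries.C c • s) = (PadicInt.toZModPow k c).val • x s
    have hs : PowerSeries.C c • s = (PadicInt.toZModPow k c).val • s := by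
      conv_lhs => rw [hb]
      rw [map_add, add_smul, map_natCast, Nat.cast_smul_eq_nsmul, map_mul, map_pow, map_natCast,
        mul_comm, mul_smul, ← Nat.cast_pow, Nat.cast_smul_eq_nsmul, hk, smul_zero, add_zero]
    rw [hs, map_nsmul]
  locNil :=
    { torsion := fun s ↦ by
        obtain ⟨⟨k, hk⟩, -⟩ := exists_pow_smul_eq_zero_and_X_pow_smul_eq_zero S hS κ ρ₀ (s : _)
        exact ⟨k, Subtype.ext (by rw [Submodule.coe_smul_of_tower, Submodule.coe_zero]; exact hk)⟩
      nil := fun s ↦ by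
        obtain ⟨-, N, hN⟩ := exists_pow_smul_eq_zero_and_X_pow_smul_eq_zero S hS κ ρ₀ (s : _)
        refine ⟨N, ?_⟩
        set ψ' : AddMonoid.End L.selmer :=
          DistribSMul.toAddMonoidHom L.selmer (PowerSeries.X : PowerSeries ℤ_[p]) with hψ'
        have hpow : ∀ (n : ℕ) (t : L.selmer), (ψ' ^ n) t = (PowerSeries.X : PowerSeries ℤ_[p]) ^ n • t := by
          intro n t
          induction n generalizing t with
          | zero => rw [pow_zero, pow_zero, one_smul, AddMonoid.End.one_apply]
          | succ n ih =>
            rw [pow_succ, AddMonoid.End.coe_mul, Function.comp_apply, ih]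
            change (PowerSeries.X : PowerSeries ℤ_[p]) ^ n • ((PowerSeries.X : PowerSeries ℤ_[p]) • t) = _
            rw [← mul_smul, ← pow_succ]
        rw [hpow]
        exact Subtype.ext (by rw [Submodule.coe_smul, Submodule.coe_zero]; exact hN) }

end Landing

/-! ## §3 The [RH]-transport -/

section Transport

variable {K : Type} [Field K] [NumberField K] (S : Set (HeightOneSpectrum (𝓞 K))) {p : ℕ} [Fact p.Prime]
  {A : Type} [AddCommGroup A] [Module ℤ_[p] A] [TopologicalSpace A] [DiscreteTopology A]
  [TopologicalSpace (PowerSeries ℤ_[p])] [IsTopologicalRing (PowerSeries ℤ_[p])]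
  [IsTopologicalAddGroup (BigRepModule ℤ_[p] p A)] [ContinuousSMul (PowerSeries ℤ_[p]) (BigRepModule ℤ_[p] p A)]
  (hS : ∀ v : HeightOneSpectrum (𝓞 K), ((p : ℕ) : 𝓞 K) ∈ v.asIdeal → v ∈ S)
  (κ : ZpExtension K p) (ρ₀ : ContinuousRep (GaloisGroupUnramifiedOutside K S) ℤ_[p] A)
  {M : Type} [AddCommGroup M] [DistribMulAction (absoluteGaloisGroup K) M] [TopologicalSpace M]
  [DiscreteTopology M]
  (ψ : A ≃+ M) (hψ : ∀ (σ : absoluteGaloisGroup K) (a : A), ψ (ρ₀ (toUnramifiedQuot K S σ) a) = σ • ψ a)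

include hψ in
/-- **THE [RH]-TRANSPORT: `corank_Λ S_{𝓛_v}(K, 𝐃₁) = 0` and `S_{𝓛_v}(K, 𝐃₁)` cofinitely generated, from the
Rubin–Hida cotorsion of `H¹_{𝓕_nr}(K_∞, M)`.** Data: `M` discrete `p`-primary with open stabilisers, a
topological generator `γ` of `κ`, `p = v v̄` the only places above `p`, and a `Λ`-dual datum `D` of
`unrSelmer κ M v̄ ∅` (Greenberg–Vatsal / Keller–Yin `DatumDualData`) which is FINITELY GENERATED AND
TORSION. Along the Shapiro descent `S_{𝓛_v}(K, 𝐃₁) ↪ unrSelmer κ M v̄ ∅` (§1, injective by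
`…Shapiro`), which intertwines `T` with `conj_γ − 1` (`shapiroDescent_X_smul`), the functoriality of
dual pairs (`IwasawaDual.IsDualPair.exists_linearMap_comp_surjective`) produces a `Λ`-LINEAR SURJECTION
`D.X ↠ Hom(S_{𝓛_v}(K, 𝐃₁), ℚ/ℤ)`; so every Pontryagin dual of `S_{𝓛_v}(K, 𝐃₁)` is finitely generated
torsion. (This is PW's hypothesis (2) "`Sel(K_∞, A)` is `Λ`-cotorsion" moved to Greenberg's side.)
[cite: KellerYin2024, Thm. 1.2.2 and Rem. 1.2.3 (ii) (arXiv:2402.12781v2 TeX L676–712)]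
[cite: Greenberg2006, Thm. 3 p. 342 ("as Λ-modules")] [cite: GreenbergLNM1716, §1 p. 60] -/
theorem hasCorank_fullAtSelmer_zero_of_datumDualData (hA : ∀ a : A, ∃ k : ℕ, p ^ k • a = 0)
    (hMtor : ∀ m : M, ∃ k : ℕ, p ^ k • m = 0)
    (hMstab : ∀ m : M, IsOpen (MulAction.stabilizer (absoluteGaloisGroup K) m : Set (absoluteGaloisGroup K)))
    {γ : absoluteGaloisGroup K} (hγ : κ.IsTopGenerator γ)
    {v vbar : HeightOneSpectrum (𝓞 K)} (hv : ((p : ℕ) : 𝓞 K) ∈ v.asIdeal) (hne : vbar ≠ v)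
    (hSp : ∀ w : HeightOneSpectrum (𝓞 K), ((p : ℕ) : 𝓞 K) ∈ w.asIdeal → w = v ∨ w = vbar)
    (D : DatumDualData κ γ M (Castella2018.AcSelmer.bdpData M p vbar) (∅ : Set (HeightOneSpectrum (𝓞 K))))
    (hDfin : Module.Finite (IwasawaAlgebra p) D.X) (hDtor : Module.IsTorsion (IwasawaAlgebra p) D.X) :
    HasCorank (PowerSeries ℤ_[p])
        (fullAtSpecification S (bigRep (κ.liftUnramifiedOutside S hS) ρ₀) (Sum.inr v)).selmer 0 ∧
      IsCofinitelyGenerated (PowerSeries ℤ_[p])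
        (fullAtSpecification S (bigRep (κ.liftUnramifiedOutside S hS) ρ₀) (Sum.inr v)).selmer := by
  set L := fullAtSpecification S (bigRep (κ.liftUnramifiedOutside S hS) ρ₀) (Sum.inr v) with hL
  obtain ⟨F, hF⟩ := exists_shapiroDescent S hS κ ρ₀ ψ hψ
  -- the two dual pairs
  have h := isDualPair_datumDualData κ vbar hMtor hMstab hγ (∅ : Set (HeightOneSpectrum (𝓞 K))) D
  have h' := isDualPair_characterModule_selmer S hS κ ρ₀ L
  -- the descent restricted to `S_𝓛`, with values in `unrSelmer κ M v̄ ∅`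
  have hmem : ∀ s : L.selmer, F (s : (bigRep (κ.liftUnramifiedOutside S hS) ρ₀).H 1) ∈
      unrSelmer κ M vbar (∅ : Set (HeightOneSpectrum (𝓞 K))) := fun s ↦
    shapiroDescent_mem_unrSelmer_of_mem_fullAtSelmer S hS κ ρ₀ ψ hψ hA hF hv hne hSp s.1 s.2
  let φ : L.selmer →+ unrSelmer κ M vbar (∅ : Set (HeightOneSpectrum (𝓞 K))) :=
    { toFun := fun s ↦ ⟨F s, hmem s⟩
      map_zero' := Subtype.ext (by simp)
      map_add' := fun s t ↦ Subtype.ext (by simp) }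
  have hφ : ∀ s : L.selmer, φ (DistribSMul.toAddMonoidHom L.selmer (PowerSeries.X : PowerSeries ℤ_[p]) s) =
      (conjUnr κ M vbar (∅ : Set (HeightOneSpectrum (𝓞 K))) γ - 1) (φ s) := fun s ↦ by
    apply Subtype.ext
    change F ((PowerSeries.X : PowerSeries ℤ_[p]) • (s : (bigRep (κ.liftUnramifiedOutside S hS) ρ₀).H 1)) =
      conjH1 κ.kerSubgroup M γ (F s) - F s
    exact shapiroDescent_X_smul S hS κ ρ₀ ψ hψ hF hγ _
  have hinj : Function.Injective φ := by
    refine (injective_iff_map_eq_zero φ).2 fun s hs ↦ ?_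
    have h0 : F (s : (bigRep (κ.liftUnramifiedOutside S hS) ρ₀).H 1) = 0 := congrArg Subtype.val hs
    obtain ⟨c, hc⟩ := oneCocycleClass_surjective _ (s : (bigRep (κ.liftUnramifiedOutside S hS) ρ₀).H 1)
    rw [← hc] at h0
    exact Subtype.ext (hc.symm.trans
      (oneCocycleClass_eq_zero_of_shapiroDescent_eq_zero S hS κ ρ₀ ψ hψ hA hF c h0))
  -- functoriality of dual pairs: `D.X ↠ Hom(S_𝓛, ℚ/ℤ)`, `Λ`-linear
  obtain ⟨G, hGsurj, -⟩ := h.exists_linearMap_comp_surjective h' φ hφ hinj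
  haveI : Module.Finite (PowerSeries ℤ_[p]) D.X := hDfin
  have hfin : Module.Finite (PowerSeries ℤ_[p]) (CharacterModule L.selmer) := Module.Finite.of_surjective G hGsurj
  have htor : Module.IsTorsion (PowerSeries ℤ_[p]) (CharacterModule L.selmer) := fun x ↦ by
    obtain ⟨y, rfl⟩ := hGsurj x
    obtain ⟨a, ha⟩ := @hDtor y
    refine ⟨a, ?_⟩
    rw [Submonoid.smul_def] at ha ⊢
    rw [← map_smul, ha, map_zero]
  refine ⟨fun Y _ _ toDual hY ↦ ?_, fun Y _ _ toDual hY ↦ ?_⟩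
  · let e := hY.linearEquiv (isDualPairing_characterModule (PowerSeries ℤ_[p]) L.selmer)
    haveI : Module.Finite (PowerSeries ℤ_[p]) Y := Module.Finite.equiv e.symm
    refine (Module.finrank_eq_zero_iff_isTorsion (R := PowerSeries ℤ_[p]) (M := Y)).mpr fun y ↦ ?_
    obtain ⟨a, ha⟩ := @htor (e y)
    refine ⟨a, e.injective ?_⟩
    rw [Submonoid.smul_def] at ha ⊢
    rw [map_smul, ha, map_zero]
  · let e := hY.linearEquiv (isDualPairing_characterModule (PowerSeries ℤ_[p]) L.selmer)
    exact Module.Finite.equiv e.symm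

end Transport



end Summit.BirchSwinnertonDyer.BirchSwinnertonDyer.Theorems.AcTwistDeformation

end
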